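import Summits.Ventures.YMGap.Census.CubeMerge
import HarnessLib

/-!
# Venture YMGap, track (b) — merging a ROW of faces inside the torus configuration integral
# (the `2`-dimensional integrations of Tomboulis's decimation, arXiv:0707.2179 §2.1 (RG2)–(RG3))

HONEST FRAMING: venture file of the cell `pub-ymgap` (QuantumFields programme), track (b); exact character calculus on
finite tori, plumbing for the exactness half of Tomboulis's Prop. III.1 (the integrations "over the bonds interior to
each 2-face of side length `ba`", §2.1).  Nothing here concerns (5.15), limits, confinement or a mass gap.

**The row-merging lemma** (`integral_prod_faceW_eq_rowState`).  Inside `∫ ⋯ ∏_b dU_b` over the links of `(ℤ/Nℤ)^d`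
consider `n ≥ 1` faces `χ`-sums `Σ_m A_m χ_m(a_i · W_{i+1} · b_i · W_i⁻¹)`, `i < n`, where `W_j = U_{e_j} · r_j(U)` for
links `e_0, …, e_n` and arbitrary continuous `a_i, b_i, r_j` and a spectator `P` that do not depend on the MERGE LINKS
`e_1, …, e_{n-1}` (pairwise distinct and distinct from `e_0, e_n`).  Integrating the merge links one after the other
(`CubeMerge.integral_faceSum_merge`, i.e. `∫ χ_m(αVβ) χ_l(γV⁻¹) dV = [m = l] χ_m(αγβ)/(m+1)`) merges the row into the
single face `Σ_m A_m^n/(m+1)^{n-1} χ_m((a_0⋯a_{n-1}) · W_n · (b_{n-1}⋯b_0) · W_0⁻¹)` (`rowState`); the companions `r_j`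
cancel inside the words.  With `r ≡ 1` this is a row of `b` plaquettes of a decimation cell merging into a `b × 1`
rectangle; with `W_j =` (a row of horizontal links) it merges the `b` rectangles into the `b × b` cell
(`LatticeQCDFlow.Scoring.integral_row_su2Character` is the periodic version with a closing handle).

References: E. T. Tomboulis, arXiv:0707.2179 §2.1 [cite: Tomboulis2007Confinement, §2.1 (RG2)–(RG3)]; A. A. Migdal,
Sov. Phys. JETP 42 (1975) 413; J.-M. Drouffe, J.-B. Zuber, Phys. Rept. 102 (1983) 1, §3.1 (gluing of plaquettes) [folklore].
-/

noncomputable section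

open MeasureTheory Finset Real Function
open scoped BigOperators
open Literature.MathematicalPhysics.QuantumLattice
open Literature.MathematicalPhysics.QuantumFieldTheory
open Literature.MathematicalPhysics.QuantumFieldTheory.Tomboulis2007
open Summit.Ventures.LatticeQCDFlow.Exactness
open Summit.Ventures.LatticeQCDFlow.Scoring

namespace Summit.Ventures.YMGap.Census

variable {d N : ℕ}

/-! ### Row data -/

/-- The `j`-th rung of the row: `W_j(U) = U_{e_j} · r_j(U)` (a link followed by a companion word). -/
def rungW (e : ℕ → Edge d N) (r : ℕ → GaugeConfig d N SU2 → SU2) (j : ℕ) (U : GaugeConfig d N SU2) : SU2 :=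
  U (e j) * r j U

/-- The `i`-th face of the row: `Σ_m A_m χ_m(a_i · W_{i+1} · b_i · W_i⁻¹)`. -/
def faceW (K : ℕ) (A : ℕ → ℝ) (a b : ℕ → GaugeConfig d N SU2 → SU2) (e : ℕ → Edge d N)
    (r : ℕ → GaugeConfig d N SU2 → SU2) (i : ℕ) (U : GaugeConfig d N SU2) : ℝ :=
  faceSum K A (a i U * rungW e r (i + 1) U * b i U * (rungW e r i U)⁻¹)

/-- `a_0 a_1 ⋯ a_k`. -/
def prodA (a : ℕ → GaugeConfig d N SU2 → SU2) (k : ℕ) (U : GaugeConfig d N SU2) : SU2 :=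
  ((List.range (k + 1)).map fun i => a i U).prod

/-- `b_k ⋯ b_1 b_0`. -/
def prodB (b : ℕ → GaugeConfig d N SU2 → SU2) (k : ℕ) (U : GaugeConfig d N SU2) : SU2 :=
  (((List.range (k + 1)).map fun i => b i U).reverse).prod

/-- The coefficients after `k` mergings of faces with coefficients `A`: `A_m^{k+1}/(m+1)^k`. -/
def mergeCoef (A : ℕ → ℝ) (k : ℕ) (m : ℕ) : ℝ := A m ^ (k + 1) / ((m : ℝ) + 1) ^ k

/-- The row after `k` mergings: `Σ_m A_m^{k+1}/(m+1)^k χ_m((a_0⋯a_k) · W_{k+1} · (b_k⋯b_0) · W_0⁻¹)`. -/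
def rowState (K : ℕ) (A : ℕ → ℝ) (a b : ℕ → GaugeConfig d N SU2 → SU2) (e : ℕ → Edge d N)
    (r : ℕ → GaugeConfig d N SU2 → SU2) (k : ℕ) (U : GaugeConfig d N SU2) : ℝ :=
  faceSum K (mergeCoef A k) (prodA a k U * rungW e r (k + 1) U * prodB b k U * (rungW e r 0 U)⁻¹)

/-! ### Algebra of the ordered products -/

/-- `prodA a 0 = a_0`. -/
theorem prodA_zero (a : ℕ → GaugeConfig d N SU2 → SU2) (U : GaugeConfig d N SU2) : prodA a 0 U = a 0 U := by
  simp [prodA]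

/-- `prodB b 0 = b_0`. -/
theorem prodB_zero (b : ℕ → GaugeConfig d N SU2 → SU2) (U : GaugeConfig d N SU2) : prodB b 0 U = b 0 U := by
  simp [prodB]

/-- `prodA a (k+1) = prodA a k · a_{k+1}`. -/
theorem prodA_succ (a : ℕ → GaugeConfig d N SU2 → SU2) (k : ℕ) (U : GaugeConfig d N SU2) :
    prodA a (k + 1) U = prodA a k U * a (k + 1) U := by
  simp [prodA, List.range_succ, List.map_append, List.prod_append, mul_assoc]

/-- `prodB b (k+1) = b_{k+1} · prodB b k`. -/
theorem prodB_succ (b : ℕ → GaugeConfig d N SU2 → SU2) (k : ℕ) (U : GaugeConfig d N SU2) :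
    prodB b (k + 1) U = b (k + 1) U * prodB b k U := by
  simp [prodB, List.range_succ, List.map_append, List.reverse_append]

/-- `mergeCoef A 0 = A`. -/
theorem mergeCoef_zero (A : ℕ → ℝ) : mergeCoef A 0 = A := by
  funext m
  simp [mergeCoef]

/-- One more merging: `mergeCoef A (k+1) m = mergeCoef A k m · A m/(m+1)`. -/
theorem mergeCoef_succ (A : ℕ → ℝ) (k m : ℕ) :
    mergeCoef A (k + 1) m = mergeCoef A k m * A m / ((m : ℝ) + 1) := by
  unfold mergeCoef
  have h : ((m : ℝ) + 1) ≠ 0 := by positivity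
  field_simp
  ring

/-- The face `0` is the row state before any merging. -/
theorem faceW_zero_eq_rowState (K : ℕ) (A : ℕ → ℝ) (a b : ℕ → GaugeConfig d N SU2 → SU2) (e : ℕ → Edge d N)
    (r : ℕ → GaugeConfig d N SU2 → SU2) (U : GaugeConfig d N SU2) :
    faceW K A a b e r 0 U = rowState K A a b e r 0 U := by
  simp only [faceW, rowState, prodA_zero, prodB_zero, mergeCoef_zero]

/-! ### The merging step -/

/-- Continuity of a rung. -/
theorem continuous_rungW (e : ℕ → Edge d N) {r : ℕ → GaugeConfig d N SU2 → SU2} (hr : ∀ j, Continuous (r j)) (j : ℕ) :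
    Continuous (rungW e r j) :=
  (continuous_apply (e j)).mul (hr j)

/-- Continuity of `prodA`. -/
theorem continuous_prodA {a : ℕ → GaugeConfig d N SU2 → SU2} (ha : ∀ i, Continuous (a i)) (k : ℕ) :
    Continuous (prodA a k) := by
  induction k with
  | zero =>
    have h : prodA a 0 = a 0 := funext fun U => prodA_zero a U
    rw [h]; exact ha 0
  | succ k ih =>
    have h : prodA a (k + 1) = fun U => prodA a k U * a (k + 1) U := funext fun U => prodA_succ a k U
    rw [h]; exact ih.mul (ha _)

/-- Continuity of `prodB`. -/
theorem continuous_prodB {b : ℕ → GaugeConfig d N SU2 → SU2} (hb : ∀ i, Continuous (b i)) (k : ℕ) :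
    Continuous (prodB b k) := by
  induction k with
  | zero =>
    have h : prodB b 0 = b 0 := funext fun U => prodB_zero b U
    rw [h]; exact hb 0
  | succ k ih =>
    have h : prodB b (k + 1) = fun U => b (k + 1) U * prodB b k U := funext fun U => prodB_succ b k U
    rw [h]; exact (hb _).mul ih

/-- Continuity of a face. -/
theorem continuous_faceW (K : ℕ) (A : ℕ → ℝ) {a b : ℕ → GaugeConfig d N SU2 → SU2} (e : ℕ → Edge d N)
    {r : ℕ → GaugeConfig d N SU2 → SU2} (ha : ∀ i, Continuous (a i)) (hb : ∀ i, Continuous (b i))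
    (hr : ∀ j, Continuous (r j)) (i : ℕ) : Continuous (faceW K A a b e r i) := by
  unfold faceW
  exact (continuous_faceSum K A).comp
    ((((ha i).mul (continuous_rungW e hr _)).mul (hb i)).mul (continuous_rungW e hr _).inv)

/-- `prodA` ignores a link that every `a_i` ignores. -/
theorem prodA_update {a : ℕ → GaugeConfig d N SU2 → SU2} {E : Edge d N} (ha : ∀ i U g, a i (update U E g) = a i U)
    (k : ℕ) (U : GaugeConfig d N SU2) (g : SU2) : prodA a k (update U E g) = prodA a k U := by
  simp only [prodA, ha]

/-- `prodB` ignores a link that every `b_i` ignores. -/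
theorem prodB_update {b : ℕ → GaugeConfig d N SU2 → SU2} {E : Edge d N} (hb : ∀ i U g, b i (update U E g) = b i U)
    (k : ℕ) (U : GaugeConfig d N SU2) (g : SU2) : prodB b k (update U E g) = prodB b k U := by
  simp only [prodB, hb]

/-- A rung on another link ignores the link `E`. -/
theorem rungW_update {e : ℕ → Edge d N} {r : ℕ → GaugeConfig d N SU2 → SU2} {E : Edge d N} {j : ℕ}
    (hj : e j ≠ E) (hr : ∀ U g, r j (update U E g) = r j U) (U : GaugeConfig d N SU2) (g : SU2) :
    rungW e r j (update U E g) = rungW e r j U := by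
  simp only [rungW, update_of_ne hj, hr]

/-- Merge data `β_k = r_{k+1} · (b_k⋯b_0) · W_0⁻¹` (what follows the merge link in the row state). -/
def mergeβ (b : ℕ → GaugeConfig d N SU2 → SU2) (e : ℕ → Edge d N) (r : ℕ → GaugeConfig d N SU2 → SU2) (k : ℕ)
    (U : GaugeConfig d N SU2) : SU2 :=
  r (k + 1) U * prodB b k U * (rungW e r 0 U)⁻¹

/-- Merge data `γ_k = a_{k+1} · W_{k+2} · b_{k+1} · r_{k+1}⁻¹` (what precedes the inverse merge link in face `k+1`). -/
def mergeγ (a b : ℕ → GaugeConfig d N SU2 → SU2) (e : ℕ → Edge d N) (r : ℕ → GaugeConfig d N SU2 → SU2) (k : ℕ)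
    (U : GaugeConfig d N SU2) : SU2 :=
  a (k + 1) U * rungW e r (k + 2) U * b (k + 1) U * (r (k + 1) U)⁻¹

/-- The row state in merge position: `χ(prodA · U_{e_{k+1}} · β_k)`. -/
theorem rowState_eq_merge (K : ℕ) (A : ℕ → ℝ) (a b : ℕ → GaugeConfig d N SU2 → SU2) (e : ℕ → Edge d N)
    (r : ℕ → GaugeConfig d N SU2 → SU2) (k : ℕ) (U : GaugeConfig d N SU2) :
    rowState K A a b e r k U = faceSum K (mergeCoef A k) (prodA a k U * U (e (k + 1)) * mergeβ b e r k U) := by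
  simp only [rowState, rungW, mergeβ, mul_assoc]

/-- The face `k+1` in merge position: `χ(γ_k · U_{e_{k+1}}⁻¹)`. -/
theorem faceW_succ_eq_merge (K : ℕ) (A : ℕ → ℝ) (a b : ℕ → GaugeConfig d N SU2 → SU2) (e : ℕ → Edge d N)
    (r : ℕ → GaugeConfig d N SU2 → SU2) (k : ℕ) (U : GaugeConfig d N SU2) :
    faceW K A a b e r (k + 1) U = faceSum K A (mergeγ a b e r k U * (U (e (k + 1)))⁻¹) := by
  simp only [faceW, rungW, mergeγ, mul_inv_rev, mul_assoc]

/-- The merged word is the next row state's word (the companion `r_{k+1}` cancels). -/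
theorem merge_word (a b : ℕ → GaugeConfig d N SU2 → SU2) (e : ℕ → Edge d N) (r : ℕ → GaugeConfig d N SU2 → SU2)
    (k : ℕ) (U : GaugeConfig d N SU2) :
    prodA a k U * mergeγ a b e r k U * mergeβ b e r k U =
      prodA a (k + 1) U * rungW e r (k + 2) U * prodB b (k + 1) U * (rungW e r 0 U)⁻¹ := by
  simp only [mergeβ, mergeγ, prodA_succ, prodB_succ, mul_assoc, inv_mul_cancel_left]

section Merge

variable [NeZero N]

/-- **The merging step.**  After `k` mergings, integrating the merge link `e_{k+1}` merges the face `k+1` into the row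
state (all data independent of `e_{k+1}`; `e_j ≠ e_{k+1}` for the other rungs `j ≤ n`). -/
theorem integral_rowState_step (K : ℕ) (A : ℕ → ℝ) {a b : ℕ → GaugeConfig d N SU2 → SU2} {e : ℕ → Edge d N}
    {r : ℕ → GaugeConfig d N SU2 → SU2} {P : GaugeConfig d N SU2 → ℝ} {n k : ℕ} (hkn : k + 2 ≤ n)
    (ha : ∀ i U g, a i (update U (e (k + 1)) g) = a i U) (hb : ∀ i U g, b i (update U (e (k + 1)) g) = b i U)
    (hr : ∀ j U g, r j (update U (e (k + 1)) g) = r j U) (hP : ∀ U g, P (update U (e (k + 1)) g) = P U)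
    (he : ∀ j ≤ n, j ≠ k + 1 → e j ≠ e (k + 1))
    (hac : ∀ i, Continuous (a i)) (hbc : ∀ i, Continuous (b i)) (hrc : ∀ j, Continuous (r j)) (hPc : Continuous P) :
    ∫ U, rowState K A a b e r k U * (∏ i ∈ Finset.Ico (k + 1) n, faceW K A a b e r i U) * P U
        ∂(Measure.pi fun _ : Edge d N => haarProbability SU2) =
      ∫ U, rowState K A a b e r (k + 1) U * (∏ i ∈ Finset.Ico (k + 2) n, faceW K A a b e r i U) * P U
        ∂(Measure.pi fun _ : Edge d N => haarProbability SU2) := by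
  have hsplit : ∀ U, (∏ i ∈ Finset.Ico (k + 1) n, faceW K A a b e r i U) =
      faceW K A a b e r (k + 1) U * ∏ i ∈ Finset.Ico (k + 2) n, faceW K A a b e r i U :=
    fun U => Finset.prod_eq_prod_Ico_succ_bot (by omega : k + 1 < n) _
  have hL : ∀ U, rowState K A a b e r k U * (∏ i ∈ Finset.Ico (k + 1) n, faceW K A a b e r i U) * P U =
      faceSum K (mergeCoef A k) (prodA a k U * U (e (k + 1)) * mergeβ b e r k U) *
        faceSum K A (mergeγ a b e r k U * (U (e (k + 1)))⁻¹) *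
        ((∏ i ∈ Finset.Ico (k + 2) n, faceW K A a b e r i U) * P U) := by
    intro U
    rw [hsplit, rowState_eq_merge, faceW_succ_eq_merge]
    ring
  simp_rw [hL]
  -- independence of `e (k+1)` and continuity
  have he0 : e 0 ≠ e (k + 1) := he 0 (Nat.zero_le _) (by omega)
  have he2 : e (k + 2) ≠ e (k + 1) := he (k + 2) hkn (by omega)
  have hα : ∀ U g, prodA a k (update U (e (k + 1)) g) = prodA a k U := fun U g => prodA_update ha k U g
  have hβ : ∀ U g, mergeβ b e r k (update U (e (k + 1)) g) = mergeβ b e r k U := fun U g => by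
    simp only [mergeβ, hr, prodB_update hb, rungW_update he0 (hr 0)]
  have hγ : ∀ U g, mergeγ a b e r k (update U (e (k + 1)) g) = mergeγ a b e r k U := fun U g => by
    simp only [mergeγ, ha, hb, hr, rungW_update he2 (hr (k + 2))]
  have hfaceU : ∀ i ∈ Finset.Ico (k + 2) n, ∀ U g,
      faceW K A a b e r i (update U (e (k + 1)) g) = faceW K A a b e r i U := by
    intro i hi U g
    have hi' := Finset.mem_Ico.1 hi
    have hi1 : e i ≠ e (k + 1) := he i (by omega) (by omega)
    have hi2 : e (i + 1) ≠ e (k + 1) := he (i + 1) (by omega) (by omega)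
    simp only [faceW, ha, hb, rungW_update hi1 (hr i), rungW_update hi2 (hr (i + 1))]
  have hQ : ∀ U g, (∏ i ∈ Finset.Ico (k + 2) n, faceW K A a b e r i (update U (e (k + 1)) g)) * P (update U (e (k + 1)) g)
      = (∏ i ∈ Finset.Ico (k + 2) n, faceW K A a b e r i U) * P U := fun U g => by
    rw [hP, Finset.prod_congr rfl fun i hi => hfaceU i hi U g]
  have hαc : Continuous (prodA a k) := continuous_prodA hac k
  have hβc : Continuous (mergeβ b e r k) := by
    unfold mergeβ
    exact ((hrc _).mul (continuous_prodB hbc k)).mul (continuous_rungW e hrc 0).inv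
  have hγc : Continuous (mergeγ a b e r k) := by
    unfold mergeγ
    exact (((hac _).mul (continuous_rungW e hrc _)).mul (hbc _)).mul (hrc _).inv
  have hQc : Continuous fun U => (∏ i ∈ Finset.Ico (k + 2) n, faceW K A a b e r i U) * P U :=
    (continuous_finsetProd _ fun i _ => continuous_faceW K A e hac hbc hrc i).mul hPc
  rw [integral_faceSum_merge (e (k + 1)) K (mergeCoef A k) A (prodA a k) (mergeβ b e r k) (mergeγ a b e r k)
    (fun U => (∏ i ∈ Finset.Ico (k + 2) n, faceW K A a b e r i U) * P U) hα hβ hγ hQ hαc hβc hγc hQc]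
  refine integral_congr_ae (ae_of_all _ fun U => ?_)
  -- identify the merged face with the next row state
  have hcoef : (fun m => mergeCoef A k m * A m / ((m : ℝ) + 1)) = mergeCoef A (k + 1) :=
    funext fun m => (mergeCoef_succ A k m).symm
  show faceSum K (fun m => mergeCoef A k m * A m / ((m : ℝ) + 1))
      (prodA a k U * mergeγ a b e r k U * mergeβ b e r k U) *
      ((∏ i ∈ Finset.Ico (k + 2) n, faceW K A a b e r i U) * P U) =
    rowState K A a b e r (k + 1) U * (∏ i ∈ Finset.Ico (k + 2) n, faceW K A a b e r i U) * P U
  rw [hcoef, merge_word, ← mul_assoc]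
  rfl

/-- **The row after `k` mergings** (`k + 1 ≤ n`). -/
theorem integral_prod_faceW_eq_rowState_step (K : ℕ) (A : ℕ → ℝ) {a b : ℕ → GaugeConfig d N SU2 → SU2}
    {e : ℕ → Edge d N} {r : ℕ → GaugeConfig d N SU2 → SU2} {P : GaugeConfig d N SU2 → ℝ} {n : ℕ}
    (ha : ∀ k, 1 ≤ k → k + 1 ≤ n → ∀ i U g, a i (update U (e k) g) = a i U)
    (hb : ∀ k, 1 ≤ k → k + 1 ≤ n → ∀ i U g, b i (update U (e k) g) = b i U)
    (hr : ∀ k, 1 ≤ k → k + 1 ≤ n → ∀ j U g, r j (update U (e k) g) = r j U)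
    (hP : ∀ k, 1 ≤ k → k + 1 ≤ n → ∀ U g, P (update U (e k) g) = P U)
    (he : ∀ k, 1 ≤ k → k + 1 ≤ n → ∀ j ≤ n, j ≠ k → e j ≠ e k)
    (hac : ∀ i, Continuous (a i)) (hbc : ∀ i, Continuous (b i)) (hrc : ∀ j, Continuous (r j)) (hPc : Continuous P)
    (k : ℕ) (hk : k + 1 ≤ n) :
    ∫ U, (∏ i ∈ Finset.range n, faceW K A a b e r i U) * P U ∂(Measure.pi fun _ : Edge d N => haarProbability SU2) =
      ∫ U, rowState K A a b e r k U * (∏ i ∈ Finset.Ico (k + 1) n, faceW K A a b e r i U) * P U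
        ∂(Measure.pi fun _ : Edge d N => haarProbability SU2) := by
  induction k with
  | zero =>
    refine integral_congr_ae (ae_of_all _ fun U => ?_)
    dsimp only
    rw [Finset.range_eq_Ico, Finset.prod_eq_prod_Ico_succ_bot (by omega : 0 < n), faceW_zero_eq_rowState]
  | succ k ih =>
    rw [ih (by omega)]
    exact integral_rowState_step K A (by omega) (ha (k + 1) (by omega) hk) (hb (k + 1) (by omega) hk)
      (hr (k + 1) (by omega) hk) (hP (k + 1) (by omega) hk) (he (k + 1) (by omega) hk) hac hbc hrc hPc

/-- **The row-merging lemma.**  A row of `n ≥ 1` faces `Σ_m A_m χ_m(a_i W_{i+1} b_i W_i⁻¹)` whose merge links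
`e_1, …, e_{n-1}` are seen by nothing else integrates to the single merged face
`Σ_m A_m^n/(m+1)^{n-1} χ_m((a_0⋯a_{n-1}) W_n (b_{n-1}⋯b_0) W_0⁻¹)` (arXiv:0707.2179 §2.1: "the integrations over the
bonds interior to each 2-face … are exact"). -/
theorem integral_prod_faceW_eq_rowState (K : ℕ) (A : ℕ → ℝ) {a b : ℕ → GaugeConfig d N SU2 → SU2}
    {e : ℕ → Edge d N} {r : ℕ → GaugeConfig d N SU2 → SU2} {P : GaugeConfig d N SU2 → ℝ} {n : ℕ} (hn : 1 ≤ n)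
    (ha : ∀ k, 1 ≤ k → k + 1 ≤ n → ∀ i U g, a i (update U (e k) g) = a i U)
    (hb : ∀ k, 1 ≤ k → k + 1 ≤ n → ∀ i U g, b i (update U (e k) g) = b i U)
    (hr : ∀ k, 1 ≤ k → k + 1 ≤ n → ∀ j U g, r j (update U (e k) g) = r j U)
    (hP : ∀ k, 1 ≤ k → k + 1 ≤ n → ∀ U g, P (update U (e k) g) = P U)
    (he : ∀ k, 1 ≤ k → k + 1 ≤ n → ∀ j ≤ n, j ≠ k → e j ≠ e k)
    (hac : ∀ i, Continuous (a i)) (hbc : ∀ i, Continuous (b i)) (hrc : ∀ j, Continuous (r j)) (hPc : Continuous P) :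
    ∫ U, (∏ i ∈ Finset.range n, faceW K A a b e r i U) * P U ∂(Measure.pi fun _ : Edge d N => haarProbability SU2) =
      ∫ U, rowState K A a b e r (n - 1) U * P U ∂(Measure.pi fun _ : Edge d N => haarProbability SU2) := by
  rw [integral_prod_faceW_eq_rowState_step K A ha hb hr hP he hac hbc hrc hPc (n - 1) (by omega)]
  refine integral_congr_ae (ae_of_all _ fun U => ?_)
  simp only [show n - 1 + 1 = n by omega, Finset.Ico_self, Finset.prod_empty, mul_one]

end Merge

end Summit.Ventures.YMGap.Census

end
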